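import Mathlib
import Literature.Analysis.FluidPDE.TypeIAncientMild
import Literature.Analysis.FluidPDE.TypeIAncientMildClassical
import Literature.Analysis.FluidPDE.GigaMiura2011ScaledAlignmentBlowupLimitHolds
import Literature.Analysis.FluidPDE.CurlFreeLiouville
import Literature.Analysis.FluidPDE.VorticityCalculus
import Literature.Analysis.FluidPDE.SpaceTimeCalculus
import Literature.Analysis.FluidPDE.AxisymmetricVorticityTransport
import Literature.Analysis.FluidPDE.TsaiMaximumPrinciple
import Literature.Analysis.FluidPDE.LocalBiotSavartCalculus
import Literature.Analysis.FluidPDE.LerayProfileCalculus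
import Literature.Analysis.PDE.PoissonBall
import Summits.NavierStokesRegularity.NavierStokesRegularity.Theorems.SymmetryModuliCountStretchingCertificateComparisonKato
import HarnessLib
import Summits.NavierStokesRegularity.NavierStokesRegularity.Theorems.ScenarioCensusModeRankShell

/-!
# Census row A1apT, in-row members A1fm / A1e1 / A1cx0 (instrument «FLOQUET METER») — LINE «floquet-meter» REV 1 port, part 1/3: the gauge (§A, shared
# lemmas taken BY NAME from the mode-rank port), vorticity bounds on compact windows (§B), the periodic parabolic barrier (§C), Floquet relations (§D)

Re-homed for the scenario census (typer seat ns-census-typer-1 g8; the cells A1fm / A1e1 / A1cx0 are MEMBERS OF RECORD «DECIDED IN KERNEL IN FILES» of row A1apT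
since census v1.72 (critic idea-crit-3 g7 PASS 23:21:11Z; ref ns-census-ref g9 PRE-CHECK ✓ §14.18 item 30; lead-presearch label), A1cx since v1.71 (temporal-spectrum
REV 4; restated VERBATIM here and decided by nesting); this port makes them TREE-decided): VERBATIM PORT of ns-idea-2 LINE g13-1 «floquet-meter» REV 1,
`pub/ideators/ns-idea-2/lines/floquet-meter/line-floquet-meter.lean` sha16 add9e8af7413777b (750 l., lean check rc 0, 0 sorry), split for the 400-line rule into
`ScenarioCensusFloquetMeter` (§A–§D) → `…FloquetMeterRow` (§E) → `…FloquetMeterCells` (§F–§G + census KEYS).  Lean text VERBATIM in namespace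
`…Theorems.ScenarioCensus.FloquetMeter` (the line's `…Lines.FloquetMeter` re-homed); port edits: `local notation "E3"` → `abbrev E3` (typer lint: no notation in
port files), `@[conjecture]` on the OPEN head `Row_A1fr` and next cell `Row_A1fs` (typed only), seven one-line docstrings added (gate lint); the §A lemmas the line
shares verbatim with «mode-rank» are taken BY NAME from the landed mode-rank port (listed below), `tendsto_typeI_bound` is not re-declared (used only there) and
the coordinate bound `abs_apply_le_norm'` (twin of landed Literature lemmas) is replaced at its one use by Mathlib's `PiLp.norm_apply_le` (proof text only).
Statements untouched.

No census VALUE is moved here (row A1apT keeps its value; the members become TREE-decided by name); NS regularity is NOT proved; (L′) ⟨10661⟩ is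
untouched; no summit statement is proved by this file. Lemmas that restate already-landed tree declarations are taken BY NAME (gate lint `dedup.landed`): `apply_eq_apply_of_harmonic_bounded` = `ModeRank.apply_eq_apply_of_harmonic_bounded`, `apply_eq_apply_of_curl_const` = `ModeRank.apply_eq_apply_of_curl_const`, `tendsto_slice_atBot` = `ModeRank.tendsto_slice_atBot`, `eq_zero_of_curl_slice_const` = `ModeRank.eq_zero_of_curl_slice_const`.
-/

-- the summit and its single problem share the name `NavierStokesRegularity` (D-0017 nested layout)
set_option linter.dupNamespace false

noncomputable section

open Set Function Filter Topology

namespace Summit.NavierStokesRegularity.NavierStokesRegularity.Theorems.ScenarioCensus.FloquetMeter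

open Literature.Analysis Literature.Analysis.FluidPDE InnerProductSpace
open Summit.NavierStokesRegularity.NavierStokesRegularity.Theorems (vorticity_eq_deriv_of_typeI)
open scoped Laplacian InnerProductSpace RealInnerProductSpace ContDiff

/-- `ℝ³` (the line's `local notation "E3"`, spelled as a reducible abbreviation for the tree). -/
abbrev E3 := EuclideanSpace ℝ (Fin 3)

/-! ## A. Spatial Liouville lemmas and the gauge (shared verbatim with lines «mode-rank»,
«temporal-spectrum» of this seat) -/

-- `apply_eq_apply_of_harmonic_bounded`: the line restates the tree's `ModeRank.apply_eq_apply_of_harmonic_bounded`; taken BY NAME (gate lint dedup.landed).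

-- `apply_eq_apply_of_curl_const`: the line restates the tree's `ModeRank.apply_eq_apply_of_curl_const`; taken BY NAME (gate lint dedup.landed).

-- `tendsto_typeI_bound`: the Type-I envelope lemma is used only by `tendsto_slice_atBot` (taken BY NAME from the mode-rank port); not re-declared.

-- `tendsto_slice_atBot`: the line restates the tree's `ModeRank.tendsto_slice_atBot`; taken BY NAME (gate lint dedup.landed).

-- `eq_zero_of_curl_slice_const`: the line restates the tree's `ModeRank.eq_zero_of_curl_slice_const`; taken BY NAME (gate lint dedup.landed).

/-! ## B. The vorticity of the class is bounded on compact time windows (derived, not assumed) -/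

-- `abs_apply_le_norm'`: the coordinate bound `|w i| ≤ ‖w‖` restates landed Literature lemmas (gate lint dedup.landed); not re-declared — its one use below is Mathlib's `PiLp.norm_apply_le` (port edit, proof text only).

/-- `‖curl v(x)‖ ≤ 4 ‖Dv(x)‖` (each vorticity component is a difference of two Jacobian entries). -/
theorem norm_curl_le_four_mul (v : E3 → E3) (x : E3) : ‖curl v x‖ ≤ 4 * ‖fderiv ℝ v x‖ := by
  have hD : ∀ j i : Fin 3, |fderiv ℝ v x (EuclideanSpace.single j 1) i| ≤ ‖fderiv ℝ v x‖ := by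
    intro j i
    have h1 : |fderiv ℝ v x (EuclideanSpace.single j 1) i|
        ≤ ‖fderiv ℝ v x (EuclideanSpace.single j 1)‖ := by
          simpa only [Real.norm_eq_abs] using PiLp.norm_apply_le (fderiv ℝ v x (EuclideanSpace.single j 1)) i
    have h2 := (fderiv ℝ v x).le_opNorm (EuclideanSpace.single j 1)
    have hs : ‖(EuclideanSpace.single j (1:ℝ) : E3)‖ = 1 := by simp
    rw [hs, mul_one] at h2
    exact h1.trans h2
  have h0 : curl v x 0 = fderiv ℝ v x (EuclideanSpace.single 1 1) 2
      - fderiv ℝ v x (EuclideanSpace.single 2 1) 1 := by simp [curl]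
  have h1 : curl v x 1 = fderiv ℝ v x (EuclideanSpace.single 2 1) 0
      - fderiv ℝ v x (EuclideanSpace.single 0 1) 2 := by simp [curl]
  have h2 : curl v x 2 = fderiv ℝ v x (EuclideanSpace.single 0 1) 1
      - fderiv ℝ v x (EuclideanSpace.single 1 1) 0 := by simp [curl]
  have hc0 : |curl v x 0| ≤ 2 * ‖fderiv ℝ v x‖ := by
    rw [h0]; exact (abs_sub _ _).trans (by linarith [hD 1 2, hD 2 1])
  have hc1 : |curl v x 1| ≤ 2 * ‖fderiv ℝ v x‖ := by
    rw [h1]; exact (abs_sub _ _).trans (by linarith [hD 2 0, hD 0 2])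
  have hc2 : |curl v x 2| ≤ 2 * ‖fderiv ℝ v x‖ := by
    rw [h2]; exact (abs_sub _ _).trans (by linarith [hD 0 1, hD 1 0])
  have hsq : ‖curl v x‖ ^ 2 ≤ (4 * ‖fderiv ℝ v x‖) ^ 2 := by
    rw [EuclideanSpace.norm_sq_eq, Fin.sum_univ_three]
    simp only [Real.norm_eq_abs]
    nlinarith [sq_abs (curl v x 0), sq_abs (curl v x 1), sq_abs (curl v x 2),
      abs_nonneg (curl v x 0), abs_nonneg (curl v x 1), abs_nonneg (curl v x 2),
      norm_nonneg (fderiv ℝ v x)]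
  exact (pow_le_pow_iff_left₀ (norm_nonneg _) (by positivity) two_ne_zero).mp hsq

/-- **The vorticity of the class is bounded on every compact time window `[B₁, B₂]`, `B₂ < 0`**
(ONE constant for the whole window; derived from the tree): shift time by `δ₀ = -B₂/2`
(`comp_sub_right`: the shifted field is in the class and bounded by `C/√δ₀` up to `t = 0`), apply the
tree's bounded-mild derivative bootstrap `exists_norm_iteratedFDeriv_le_of_bounded_oseenMild` (order `1`,
uniform on a window), and use `‖curl v‖ ≤ 4‖Dv‖`. -/
theorem typeI_exists_curl_bound_window {C : ℝ} {u : ℝ → E3 → E3} (hu : IsTypeIAncientMild C u)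
    {B₁ B₂ : ℝ} (hB : B₁ ≤ B₂) (hB₂ : B₂ < 0) :
    ∃ A : ℝ, ∀ t ∈ Icc B₁ B₂, ∀ x, ‖curl (u t) x‖ ≤ A := by
  set δ₀ : ℝ := -B₂ / 2 with hδ₀def
  have hδ₀ : 0 < δ₀ := by rw [hδ₀def]; linarith
  set ℓ : ℝ := B₂ - B₁ + 1 + δ₀ / 2 with hℓdef
  have hℓ : (0 : ℝ) < ℓ := by rw [hℓdef]; linarith
  obtain ⟨K, hK⟩ :=
    exists_norm_iteratedFDeriv_le_of_bounded_oseenMild (C / Real.sqrt δ₀) 1 hℓ one_pos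
  have hw : IsTypeIAncientMild C (fun t => u (t - δ₀)) := hu.comp_sub_right hδ₀.le
  set a : ℝ := B₁ + δ₀ - 1 with hadef
  have hAa : a - 1 < a := by linarith
  have haℓ : a + ℓ < 0 := by
    rw [hadef, hℓdef, hδ₀def]; linarith
  have hcont : ContinuousOn (uncurry fun t => u (t - δ₀)) (Ioo (a - 1) 0 ×ˢ univ) :=
    hw.continuousOn_uncurry.mono (prod_mono Ioo_subset_Iio_self Subset.rfl)
  have hdiv : ∀ t ∈ Ioo (a - 1) 0, IsWeaklyDivFree ((fun t => u (t - δ₀)) t) :=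
    fun t ht => hw.isWeaklyDivFree ht.2
  have hmild : ∀ s t : ℝ, a - 1 < s → s < t → t < 0 → ∀ x,
      (fun t => u (t - δ₀)) t x
        = UnboundedOperators.heatExtension ((fun t => u (t - δ₀)) s) (t - s) x
          - oseenDuhamel 1 s (fun t => u (t - δ₀)) (fun t => u (t - δ₀)) t x :=
    fun s t _ hst ht x => hw.mild_eq_heatExtension hst ht x
  have hbd : ∀ t ∈ Ioo (a - 1) 0, ∀ x, ‖(fun t => u (t - δ₀)) t x‖ ≤ C / Real.sqrt δ₀ := by
    intro t ht x
    have h1 := hu.norm_le (t := t - δ₀) (by linarith [ht.2]) x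
    refine h1.trans ?_
    exact div_le_div_of_nonneg_left hu.nonneg (Real.sqrt_pos.2 hδ₀)
      (Real.sqrt_le_sqrt (by linarith [ht.2]))
  refine ⟨4 * K, fun t ht x => ?_⟩
  have hmem : t + δ₀ ∈ Ico (a + 1) (a + ℓ) := by
    rw [hadef, hℓdef]
    exact ⟨by linarith [ht.1], by linarith [ht.2]⟩
  have h1 : ‖iteratedFDeriv ℝ 1 (u (t + δ₀ - δ₀)) x‖ ≤ K :=
    hK hAa haℓ hcont hdiv hmild hbd (t + δ₀) hmem x
  rw [add_sub_cancel_right, ← norm_iteratedFDeriv_fderiv, norm_iteratedFDeriv_zero] at h1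
  exact (norm_curl_le_four_mul (u t) x).trans (by linarith)

/-! ## C. The periodic parabolic barrier -/

/-- **Periodic parabolic barrier (maximum principle for time-periodic subsolutions of
`∂ₜf + a f ≤ Δf` on `ℝ³`).**  Let `f : ℝ → ℝ³ → ℝ` be jointly continuous on the closed time window
`[A, A + 2τ]`, with `C²` slices, bounded above there, `τ`-periodic across the window
(`f (t + τ) = f t` for `t ∈ [A, A + τ]`), and a subsolution `∂ₜf + a f ≤ Δ f` at interior times with
`a > 0`.  Then `f ≤ 0` on the window.  Proof: maximise `f - δ‖x‖²` over `[A, A+2τ] × B̄(0,R)`; the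
boundedness pushes the maximiser into the open ball, PERIODICITY moves it to an interior time, and at an
interior maximum `∂ₜf = 0`, `Δ(f - δ‖x‖²) ≤ 0`, so `a f ≤ 6δ`; letting `δ → 0` gives the claim.  This is
the parabolic replacement of the elliptic barrier `nonpos_of_mul_le_laplacian` of the companion lines. -/
theorem periodic_parabolic_barrier {f : ℝ → E3 → ℝ} {A τ a M : ℝ} (hτ : 0 < τ) (ha : 0 < a)
    (hcont : ContinuousOn (uncurry f) (Icc A (A + 2 * τ) ×ˢ univ))
    (hC2 : ∀ t ∈ Icc A (A + 2 * τ), ContDiff ℝ 2 (f t))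
    (hper : ∀ t ∈ Icc A (A + τ), ∀ x, f (t + τ) x = f t x)
    (hbd : ∀ t ∈ Icc A (A + 2 * τ), ∀ x, f t x ≤ M)
    (hsub : ∀ t ∈ Ioo A (A + 2 * τ), ∀ x,
      deriv (fun s => f s x) t + a * f t x ≤ (Δ (f t)) x) :
    ∀ t ∈ Icc A (A + 2 * τ), ∀ x, f t x ≤ 0 := by
  intro t₀ ht₀ x₀
  by_contra hpos
  push Not at hpos
  set ε : ℝ := f t₀ x₀ with hε
  have hden : 0 < ‖x₀‖ ^ 2 + 6 / a := by positivity
  set δ : ℝ := ε / (2 * (‖x₀‖ ^ 2 + 6 / a)) with hδ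
  have hδ0 : 0 < δ := by positivity
  -- the radius of the spatial ball
  set R : ℝ := ‖x₀‖ + 1 + Real.sqrt (|M| / δ) with hR
  have hsq0 : 0 ≤ Real.sqrt (|M| / δ) := Real.sqrt_nonneg _
  have hRx₀ : ‖x₀‖ < R := by rw [hR]; linarith
  have hR0 : 0 ≤ R := by linarith [norm_nonneg x₀]
  have hMR : M ≤ δ * R ^ 2 := by
    have h1 : Real.sqrt (|M| / δ) ≤ R := by rw [hR]; linarith [norm_nonneg x₀]
    have h0 : 0 ≤ |M| / δ := by positivity
    have h2 : |M| / δ ≤ R ^ 2 := by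
      calc |M| / δ = Real.sqrt (|M| / δ) ^ 2 := (Real.sq_sqrt h0).symm
        _ ≤ R ^ 2 := pow_le_pow_left₀ hsq0 h1 2
    have h3 : |M| ≤ δ * R ^ 2 := by rwa [div_le_iff₀' hδ0] at h2
    exact (le_abs_self M).trans h3
  -- the compact cylinder and the barrier function
  set K : Set (ℝ × E3) := Icc A (A + 2 * τ) ×ˢ Metric.closedBall (0 : E3) R with hK
  have hKc : IsCompact K := isCompact_Icc.prod (isCompact_closedBall _ _)
  set g : ℝ × E3 → ℝ := fun p => f p.1 p.2 - δ * ‖p.2‖ ^ 2 with hg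
  have hgc : ContinuousOn g K := by
    refine ContinuousOn.sub (hcont.mono (prod_mono Subset.rfl (subset_univ _))) ?_
    exact (continuous_const.mul ((continuous_norm.comp continuous_snd).pow 2)).continuousOn
  have hmemK : (t₀, x₀) ∈ K :=
    ⟨ht₀, by rw [Metric.mem_closedBall, dist_zero_right]; exact hRx₀.le⟩
  obtain ⟨p, hpK, hpmax⟩ := hKc.exists_isMaxOn ⟨(t₀, x₀), hmemK⟩ hgc
  obtain ⟨t₁, x₁⟩ := p
  have hg0 : ε - δ * ‖x₀‖ ^ 2 ≤ f t₁ x₁ - δ * ‖x₁‖ ^ 2 := hpmax hmemK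
  have hεhalf : δ * ‖x₀‖ ^ 2 < ε := by
    have h1 : δ * (‖x₀‖ ^ 2 + 6 / a) = ε / 2 := by
      rw [hδ]; field_simp
    have h2 : 0 < δ * (6 / a) := by positivity
    nlinarith
  have ht₁ : t₁ ∈ Icc A (A + 2 * τ) := hpK.1
  have hx₁K : ‖x₁‖ ≤ R := by
    have := hpK.2; rwa [Metric.mem_closedBall, dist_zero_right] at this
  -- the maximiser lies in the open ball
  have hx₁ : ‖x₁‖ < R := by
    by_contra hnot
    have heq : ‖x₁‖ = R := le_antisymm hx₁K (not_lt.1 hnot)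
    have h1 : f t₁ x₁ - δ * ‖x₁‖ ^ 2 ≤ M - δ * R ^ 2 := by
      rw [heq]; linarith [hbd t₁ ht₁ x₁]
    linarith
  -- an interior time with the same value (periodicity)
  obtain ⟨t₂, ht₂, hft₂⟩ : ∃ t₂ ∈ Ioo A (A + 2 * τ), f t₂ x₁ = f t₁ x₁ := by
    by_cases h1 : t₁ < A + τ
    · exact ⟨t₁ + τ, ⟨by linarith [ht₁.1], by linarith⟩, hper t₁ ⟨ht₁.1, h1.le⟩ x₁⟩
    · push Not at h1
      by_cases h2 : t₁ = A + 2 * τ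
      · refine ⟨t₁ - τ, ⟨by linarith, by linarith⟩, ?_⟩
        have := hper (t₁ - τ) ⟨by linarith, by linarith⟩ x₁
        rw [sub_add_cancel] at this
        exact this.symm
      · exact ⟨t₁, ⟨by linarith, lt_of_le_of_ne ht₁.2 h2⟩, rfl⟩
  have ht₂' : t₂ ∈ Icc A (A + 2 * τ) := Ioo_subset_Icc_self ht₂
  have hmax2 : ∀ q ∈ K, f q.1 q.2 - δ * ‖q.2‖ ^ 2 ≤ f t₂ x₁ - δ * ‖x₁‖ ^ 2 := by
    intro q hq
    rw [hft₂]
    exact hpmax hq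
  -- Fermat in time at the interior time
  have htime : deriv (fun s => f s x₁) t₂ = 0 := by
    have hloc : IsLocalMax (fun s => f s x₁ - δ * ‖x₁‖ ^ 2) t₂ := by
      filter_upwards [Ioo_mem_nhds ht₂.1 ht₂.2] with s hs
      exact hmax2 (s, x₁) ⟨Ioo_subset_Icc_self hs, hpK.2⟩
    have := hloc.deriv_eq_zero
    rwa [deriv_sub_const] at this
  -- the Laplacian at the interior spatial maximiser
  have hn2 : ContDiff ℝ 2 (fun w : E3 => ‖w‖ ^ 2) := contDiff_norm_sq ℝ
  have hψ2 : ContDiff ℝ 2 (fun y => f t₂ y - δ * ‖y‖ ^ 2) :=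
    (hC2 t₂ ht₂').sub (contDiff_const.mul hn2)
  have hlocx : IsLocalMax (fun y => f t₂ y - δ * ‖y‖ ^ 2) x₁ := by
    have hball : Metric.ball (0 : E3) R ∈ 𝓝 x₁ :=
      Metric.isOpen_ball.mem_nhds (by rw [Metric.mem_ball, dist_zero_right]; exact hx₁)
    filter_upwards [hball] with y hy
    exact hmax2 (t₂, y) ⟨ht₂', Metric.ball_subset_closedBall hy⟩
  have hΔψ : (Δ (fun y => f t₂ y - δ * ‖y‖ ^ 2)) x₁ = (Δ (f t₂)) x₁ - δ * 6 := by
    have e1 : (fun y => f t₂ y - δ * ‖y‖ ^ 2) = f t₂ - δ • (fun w : E3 => ‖w‖ ^ 2) := by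
      funext z; simp
    have hs : ContDiffAt ℝ 2 (δ • fun w : E3 => ‖w‖ ^ 2) x₁ :=
      (show ContDiff ℝ 2 (δ • fun w : E3 => ‖w‖ ^ 2) from hn2.const_smul δ).contDiffAt
    rw [e1, (hC2 t₂ ht₂').contDiffAt.laplacian_sub hs,
      InnerProductSpace.laplacian_smul δ hn2.contDiffAt,
      Literature.Analysis.PDE.PoissonBall.laplacian_norm_sq, finrank_euclideanSpace_fin]
    simp only [smul_eq_mul]
    push_cast
    ring
  have hle : (Δ (fun y => f t₂ y - δ * ‖y‖ ^ 2)) x₁ ≤ 0 := laplacian_nonpos_of_isLocalMax hψ2 hlocx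
  have hs := hsub t₂ ht₂ x₁
  rw [htime, zero_add] at hs
  have h3 : a * f t₂ x₁ ≤ 6 * δ := by linarith
  have h4 : ε ≤ f t₂ x₁ + δ * ‖x₀‖ ^ 2 := by
    rw [hft₂]; nlinarith [sq_nonneg ‖x₁‖]
  have h5 : a * ε = 2 * δ * a * ‖x₀‖ ^ 2 + 12 * δ := by
    rw [hδ]; field_simp; ring
  have h6 : 0 ≤ δ * a * ‖x₀‖ ^ 2 := by positivity
  nlinarith [mul_le_mul_of_nonneg_left h4 ha.le]

/-! ## D. Floquet relations: iteration and transport into a window -/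

/-- Iterating a Floquet relation `V(t + τ) = μ V(t)` (valid while `t + τ < T`) forward `n` times. -/
theorem floquet_iter {V : ℝ → E3 → E3} {τ μ T : ℝ} (hτ : 0 ≤ τ)
    (h : ∀ t : ℝ, t + τ < T → ∀ x, V (t + τ) x = μ • V t x) :
    ∀ (n : ℕ) (t : ℝ), t + n * τ < T → ∀ x, V (t + n * τ) x = μ ^ n • V t x := by
  intro n
  induction n with
  | zero => intro t _ x; simp
  | succ n ih =>
    intro t ht x
    have h1 : t + n * τ + τ < T := by push_cast at ht; linarith
    have h2 : t + n * τ < T := by linarith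
    rw [show t + ((n + 1 : ℕ) : ℝ) * τ = t + n * τ + τ by push_cast; ring, h _ h1 x, ih t h2 x,
      smul_smul, pow_succ']

/-- Every time `t` is an integer number of periods away from the fundamental window `[A, A + τ)`:
`t = t' + nτ` or `t' = t + nτ` with `t' ∈ [A, A + τ)`, `n : ℕ` (`toIcoMod` / `toIcoDiv`). -/
theorem exists_window_repr {τ : ℝ} (hτ : 0 < τ) (A t : ℝ) :
    ∃ (n : ℕ) (t' : ℝ), t' ∈ Ico A (A + τ) ∧ (t = t' + n * τ ∨ t' = t + n * τ) := by
  refine ⟨(toIcoDiv hτ A t).natAbs, toIcoMod hτ A t, toIcoMod_mem_Ico hτ A t, ?_⟩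
  have h1 : t - (toIcoDiv hτ A t : ℝ) * τ = toIcoMod hτ A t := by
    rw [← self_sub_toIcoDiv_zsmul hτ A t, zsmul_eq_mul]
  rcases Int.natAbs_eq (toIcoDiv hτ A t) with h | h
  · left
    have h2 : ((toIcoDiv hτ A t : ℤ) : ℝ) = ((toIcoDiv hτ A t).natAbs : ℝ) := by
      rw [h]; simp
    rw [← h1, h2]; ring
  · right
    have h2 : ((toIcoDiv hτ A t : ℤ) : ℝ) = -((toIcoDiv hτ A t).natAbs : ℝ) := by
      rw [h]; simp
    rw [← h1, h2]; ring

end Summit.NavierStokesRegularity.NavierStokesRegularity.Theorems.ScenarioCensus.FloquetMeter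

end
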